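import Mathlib
import Summits.AnomalousDissipation.AnomalousDissipation.Theses.LimitingAbsorption
import Summits.AnomalousDissipation.AnomalousDissipation.Theorems.FloorUpgrade.Negative.FastClassEmpty
import Summits.AnomalousDissipation.AnomalousDissipation.Theorems.FloorUpgrade.Negative.SpeedLimitSharp
import Summits.AnomalousDissipation.AnomalousDissipation.Theorems.FloorUpgrade.Negative.SlowRegimeNoFloor
import Literature.Analysis.FluidPDE.PassiveScalarForced
import Literature.Analysis.FluidPDE.PassiveScalar
import Literature.Analysis.FluidPDE.SeisDissipationRateBound
import Summits.AnomalousDissipation.AnomalousDissipation.Theorems.LimitingAbsorptionFloorUpgradeStubSourcedSolution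
import Summits.AnomalousDissipation.AnomalousDissipation.Theorems.LimitingAbsorptionFloorUpgradeStubBoundedEnstrophyNoRelaxation
import HarnessLib

/-!
# Crux `LimitingAbsorption.FloorUpgrade` (stmt-AnomalousDissipation-15010) — line
# `material-derivative-dichotomy` (crux-plan of idea card `Ideas/material-derivative-dichotomy.md`,
# ideator 4, triage r2: pass/pass)

`FloorUpgrade := RelaxingFamily → UniformRelaxationWitness`. The line CONSUMES the relaxing family
`hR` (never `fun _ => hX`, never `¬RelaxingFamily`; Disproof §0 `not_floorUpgrade_iff`) and proves the
same-family floor along a subsequence (K1′ of `SketchIdeator5R2`, whose extraction step is re-proved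
inline in `FloorUpgrade_of`) BY CONTRADICTION through the transfer-field dichotomy:

* no floor (`P_j := limsup-mean ν_j‖∇θ_j‖² → 0` for the `h`-sourced scalars `θ_j` of the family)
  ⟹ `stub_slowTransferField` (S4_δ, the NS-free scalar-regularity half): along a subfamily, for every
  `δ > 0` there are transfer fields `χ_j`, jointly smooth with ALL derivatives of order ≤ 2 (one of them
  in time) bounded by a `δ`-dependent constant `K`, whose material derivative along `v_j` reproduces the
  steady source up to a mean-square defect `δ`:
  `limsup-mean ‖h − (∂_t + v_j·∇)χ_j‖²_{L²} ≤ δ` (typed junk-free: eventual bound on the lower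
  Lebesgue space–time integral);
* such a transfer structure in a (no-floor) relaxing Leray–Hopf family ⟹ `stub_orrTiltRigidity`
  (S3′_unif, the NS-rigidity half, HARDEST): the mean enstrophy stays bounded along a subsequence
  (transported vorticity of diverging enstrophy cannot keep the cross-foliation velocity component
  `v_j·∇χ_j = h − ∂_tχ_j − r_j` smooth: Orr tilt; the uniform-drift geometry is killed by the landed
  speed limit `FloorUpgrade.Negative.relaxation_speed_limit` in the co-moving frame);
* bounded enstrophy along a subsequence + `ν_j → 0` + `(U_h)` ⟹ `False` by Seis 2022 Remark 1 (in
  tree, proved: `Literature.Analysis.FluidPDE.Seis2022_rmk1_L2_holds`) in family form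
  (`stub_boundedEnstrophyNoRelaxation`: rising-sun phase selection + global releases + Seis);
* `stub_sourcedSolution`: the `h`-sourced weak scalar from zero datum exists globally in every
  locally bounded Leray–Hopf drift (window existence is landed:
  `exists_isWeakScalarTransportForcedOn_of_sq`; glue windows by bounded-drift uniqueness
  `forced_ae_eq_of_memLp_top`).

Quantifier discipline (triage r2-1 (ε), r2-2): the seam S4/S3′ is typed `∀ δ ∃ K(δ) ∃ χ` (a `K`
independent of `δ` is refuted kinematically by the deformed coboundary class `χ_j = sin(2πx)/2π +
ρ_j(y)`, `ρ_j → ρ ∈ C^{1,α} ∖ C²`); S3′ concludes BOUNDED ENSTROPHY frequently (not "defect > 0",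
which the uniform drift `v ≡ U e₁`, `χ = sin 2πx/(2πU)` kills); every enstrophy / defect clause is an
EVENTUAL bound on a lower Lebesgue integral (no `limsup`/Bochner junk, triage r2-1 (β)); S3′ receives
ALL clauses of the relaxing family together with the no-floor hypothesis and the transfer structure
(it is K1′ restricted to the smooth-transfer enemy, the only enemy S4 leaves alive), so neither half
is the crux reworded: S4 without NS input is the regularity theory of near-non-dissipative sourced
scalars, S3′ without S4 is an NS statement about where rough vorticity can live.

Disproof used: §0 honoured (hR consumed; X built from hR's own `(g, h, ν∘ψ, v₀∘ψ, v∘ψ, C, γ)`);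
§2/§7 `fastRelaxingFamily_false`, `Negative.relaxation_speed_limit` — honoured (no fast window; the
speed limit is USED inside S3′ against drifting transfer geometries); §5
`zeroFrequencyFloor_false_without_fast` / `Negative.SlowRegimeNoFloor` — not contradicted (no kernel
axiomatics: the negative lobes of the lag kernel are `∂_s⟨h, S(t,s)χ⟩` for a transfer field, and the
input excluding them is NS transport structure, S3′); §3 ("control the NEGATIVE part of the lag kernel
by the energy") — answered by S3′+S4; no stub is an instance of a landed `Negative/` lemma (imported
above for the scratch check). Dead lines: `Sketch` (`fun _ => hX`) and `SketchIdeator1`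
(`stub_boost ⟺ ¬RelaxingFamily`) — this composition has no boost and no window and reads hR's
`(U_h)` three times (S4: inventory; S3′: relaxation vs. sweeping; Seis).

`lean check`: sorries exactly in the four `stub_*`; `FloorUpgrade_of` concludes
`Summit.AnomalousDissipation.AnomalousDissipation.Theses.LimitingAbsorption.FloorUpgrade` by name.
-/

set_option linter.dupNamespace false

noncomputable section

open MeasureTheory Set Filter Topology
open scoped ENNReal NNReal InnerProductSpace
open Literature.Analysis Literature.Analysis.FluidPDE Literature.Analysis.FluidPDE.Torus
open Summit.AnomalousDissipation.AnomalousDissipation.Theses.LimitingAbsorption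

namespace Summit.AnomalousDissipation.AnomalousDissipation.Cruxes.FloorUpgrade.MaterialDerivativeDichotomy

/-! ## Stub 1 (support, M): the sourced scalar of a locally bounded Leray–Hopf drift exists globally -/

/-- **`stub_sourcedSolution`** (support; provable now, M). For `κ > 0`, a smooth steady source `h`
and a global Leray–Hopf velocity `v` on `T²` (any viscosity `ν`, steady force `g`, datum `v₀`) that is
essentially bounded on every slab `(0,T) × T²`, the weak solution of `∂ₜθ + v·∇θ = κΔθ + h`,
`θ(0) = 0` exists GLOBALLY (one `θ` serving every horizon `T`). Route: window existence
`exists_isWeakScalarTransportForcedOn_of_sq` (Theorems/TwoAndHalfDScalarLift2halfDRForcedLimit;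
measurability and the slab `L^∞_t L²_x` bound from `IsLerayHopfOn.weak` / `energy_bound`, weak
incompressibility from `ae_isWeaklyDivFree`, as in `IsGlobalLerayHopf.exists_release`) on the
horizons `T = n`, glued along `n` by bounded-drift uniqueness
(`KinematicSteadySourceLaw.forced_ae_eq_of_memLp_top`, Theorems/LimitingAbsorptionKinematicSteadySourceLawToolkit):
`θ t := θₙ t` for `t ∈ [n-2, n-1)` agrees a.e. with `θ_N` on `(0,T)` for `N ≥ T + 2`, and the forced
weak identity transfers along a.e.-equality of the space–time lifts. Also serves crux r2
(`UniformRelaxationWitness`, clause (ABS)). [folklore] -/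
theorem stub_sourcedSolution :
    ∀ (ν κ : ℝ) (g : UnitAddTorus (Fin 2) → EuclideanSpace ℝ (Fin 2)) (h : UnitAddTorus (Fin 2) → ℝ)
      (v₀ : UnitAddTorus (Fin 2) → EuclideanSpace ℝ (Fin 2))
      (v : ℝ → UnitAddTorus (Fin 2) → EuclideanSpace ℝ (Fin 2)),
      0 < κ → FunctionSpaces.Torus.IsSmooth h →
      IsGlobalLerayHopf ν (fun _ => g) v₀ v →
      (∀ T : ℝ, 0 < T →
        MemLp (FunctionSpaces.Torus.stLift v) ⊤ (volume.restrict (Ioo (0 : ℝ) T ×ˢ univ))) →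
      ∃ θ : ℝ → UnitAddTorus (Fin 2) → ℝ, IsWeakScalarTransportForced κ v (fun _ => h) 0 θ :=
  Theorems.FloorUpgradeMDD.stub_sourcedSolution

/-! ## Stub 2 (S4_δ, the scalar-regularity half; crux-sized, L): no floor ⟹ slow smooth transfer fields -/

/-- **`stub_slowTransferField`** (S4_δ of the card; the honest residual of the line, decide it
first). DATA: a witness of `RelaxingFamily` (all clauses verbatim: steady smooth mean-zero div-free
`g`; smooth mean-zero `h ≠ 0`; `ν_j > 0`, `ν_j → 0`; global Leray–Hopf `v_j` with force `g`, locally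
bounded on every slab; `meanEnergy (v_j) ≤ E`; `(U_h)` with `(C, γ)` from every phase), its
`h`-sourced scalars `θ_j` from zero datum, and the NO-FLOOR hypothesis in the exact polarity the
negation of K1′ delivers: `∀ ε > 0, ∀ᶠ j, limsup-mean ν_j‖∇θ_j‖² < ε` (honest, not junk: by the landed
inventory bound `RelaxationBoundsInventory` + energy inequality the Cesàro means of `ν_j‖∇θ_j‖²` are
bounded by `2√C‖h‖²/γ`, so this IS `P_j → 0`). CLAIM: along a subfamily `φ`, for every `δ > 0` there
are `K` and transfer fields `χ_j`, jointly `C^∞` on `[0,∞) × T²`, with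
`|χ_j|, ‖∇χ_j‖, |∂_i∂_k χ_j|, |∂_tχ_j|, ‖∇∂_tχ_j‖ ≤ K` on `[0,∞) × T²`, such that eventually in `j`
the mean-square transfer defect is `≤ δ`:
`∫₀ᵀ∫ |h − (∂_tχ_j + v_{φ j}·∇χ_j)|² ≤ δ T` for all large `T`.
Candidate: `χ_j` = space–time mollification of `θ_{φ j}` at a `δ`-dependent scale (`θ_j` itself is an
EXACT transfer field up to `−ν_jΔθ_j`, which → 0 in `L²_t H⁻¹` by no-floor; `‖θ_j(t)‖ ≤ 2√C‖h‖/γ`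
pointwise by Duhamel + Minkowski; `∂_tθ_j` is bounded in `H⁻²` uniformly); the defect is then
`(h − h_ℓ) − ν_j(Δθ_j)_ℓ − [commutator of v_j·∇ with the mollifier]`, and the whole content is the
commutator: net variance flux through every fixed scale vanishes in MEAN by no-floor, the claim needs
it small in `L²` (flux-in-mean ⇒ commutator-in-L²). WHY IT MIGHT FAIL: variance sloshing through a
fixed scale with zero net flux — a fluctuating, only Batchelor-smooth transfer field; the `∀ δ ∃ K(δ)`
order is forced (deformed coboundary class, triage r2-1 (ε)); the Leray–Hopf clause is available to
the prover (time-slowness / large-scale regularity of NS stirring) although the intended proof is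
kinematic. The kinematic version (drop Leray–Hopf, keep weak incompressibility + slab bounds + Cesàro
energy) is the natural STRONGER bench and the disprover's target. [folklore] -/
theorem stub_slowTransferField :
    ∀ (g : UnitAddTorus (Fin 2) → EuclideanSpace ℝ (Fin 2)) (h : UnitAddTorus (Fin 2) → ℝ) (ν : ℕ → ℝ)
      (v₀ : ℕ → UnitAddTorus (Fin 2) → EuclideanSpace ℝ (Fin 2))
      (v : ℕ → ℝ → UnitAddTorus (Fin 2) → EuclideanSpace ℝ (Fin 2)) (E C γ : ℝ),
      FunctionSpaces.Torus.IsSmooth g → FunctionSpaces.Torus.IsDivFree g →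
      FunctionSpaces.Torus.HasZeroMean g → FunctionSpaces.Torus.IsSmooth h →
      FunctionSpaces.Torus.HasZeroMean h → h ≠ 0 →
      (∀ j, 0 < ν j) → Tendsto ν atTop (𝓝 0) →
      (∀ j, IsGlobalLerayHopf (ν j) (fun _ => g) (v₀ j) (v j)) →
      (∀ (j : ℕ) (T : ℝ), 0 < T →
        MemLp (FunctionSpaces.Torus.stLift (v j)) ⊤ (volume.restrict (Ioo (0 : ℝ) T ×ˢ univ))) →
      (∀ j, meanEnergy (v j) ≤ E) → 0 ≤ C → 0 < γ →
      (∀ (j : ℕ) (s : ℝ), 0 ≤ s → ∀ (T : ℝ) (ϑ : ℝ → UnitAddTorus (Fin 2) → ℝ),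
        IsWeakScalarTransportOn T (ν j) (fun t => v j (s + t)) h ϑ →
          ∀ᵐ t ∂(volume.restrict (Ioo (0 : ℝ) T)),
            scalarL2Sq (ϑ t) ≤ C * Real.exp (-(γ * t)) * scalarL2Sq h) →
      ∀ (θ : ℕ → ℝ → UnitAddTorus (Fin 2) → ℝ),
      (∀ j, IsWeakScalarTransportForced (ν j) (v j) (fun _ => h) 0 (θ j)) →
      (∀ ε : ℝ, 0 < ε → ∀ᶠ j in atTop,
        longTimeAvgSup (fun t => ν j * (eScalarGradNormSq (θ j t)).toReal) < ε) →
      ∃ φ : ℕ → ℕ, StrictMono φ ∧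
        ∀ δ : ℝ, 0 < δ → ∃ (K : ℝ) (χ : ℕ → ℝ → UnitAddTorus (Fin 2) → ℝ),
          (∀ j, FunctionSpaces.Torus.IsSmoothSpaceTimeOn (Ici (0 : ℝ)) (χ j)) ∧
          (∀ (j : ℕ) (t : ℝ), 0 ≤ t → ∀ x : UnitAddTorus (Fin 2),
            |χ j t x| ≤ K ∧ ‖FunctionSpaces.Torus.gradient (χ j t) x‖ ≤ K ∧
            (∀ i k : Fin 2,
              |FunctionSpaces.Torus.partialDeriv i (FunctionSpaces.Torus.partialDeriv k (χ j t)) x| ≤ K) ∧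
            |FunctionSpaces.Torus.timeDerivWithin (Ici (0 : ℝ)) (χ j) t x| ≤ K ∧
            ‖FunctionSpaces.Torus.gradient (FunctionSpaces.Torus.timeDerivWithin (Ici (0 : ℝ)) (χ j) t) x‖ ≤ K) ∧
          ∀ᶠ j in atTop, ∀ᶠ T in atTop,
            ∫⁻ t in Ioo (0 : ℝ) T, ∫⁻ x,
                ‖h x - (FunctionSpaces.Torus.timeDerivWithin (Ici (0 : ℝ)) (χ j) t x +
                  ⟪v (φ j) t x, FunctionSpaces.Torus.gradient (χ j t) x⟫_ℝ)‖ₑ ^ 2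
              ≤ ENNReal.ofReal (δ * T) := by
  sorry

/-! ## Stub 3 (S3′_unif, the NS-rigidity half; HARDEST, L–XL): transfer structure ⟹ bounded enstrophy -/

/-- **`stub_orrTiltRigidity`** (S3′ of the card in the composing form of triage r2-2; the one stub
carrying new mathematics). DATA: a witness of `RelaxingFamily` (all clauses, as in
`stub_slowTransferField`), its `h`-sourced scalars `θ_j` with the no-floor hypothesis, AND the transfer
structure that `stub_slowTransferField` produces (for every `δ > 0`: `K(δ)`-bounded jointly smooth
`χ_j`, all derivatives of order ≤ 2 bounded by `K`, mean-square defect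
`∫₀ᵀ∫|h − (∂_tχ_j + v_j·∇χ_j)|² ≤ δT` eventually in `j` and `T`). CLAIM: the mean enstrophy is
bounded along a subsequence, `∃ Z, ∃ᶠ j, ∫₀ᵀ ‖∇v_j‖²₂ ≤ Z T` for all large `T` (lower Lebesgue
integral of the spectral `eGradNormSq`; finite on Leray–Hopf slabs). MECHANISM (Orr tilt): in 2-D the
vorticity `ω_j` is materially transported, smoothly sourced (`curl g`) and weakly damped (enstrophy
dissipation `η_j ≤ ‖Δg‖√E`, Alexakis–Doering, in tree); if `Z_j → ∞` the family carries long-lived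
rough vorticity, while the hypothesis makes the cross-foliation component `v_j·∇χ_j = (h − ∂_tχ_j) −
r_j` equal to a `K`-smooth field up to an `L²`-small `r_j`; a vorticity layer aligned with the leaves
of `χ_j` is tilted out of alignment at the rate `∂_τ(b/|∇χ|) −` curvature terms (`b = h − ∂_tχ_j`),
which vanishes identically only on flow-invariant foliations, where `h` would be carried into functions
of `χ` forever and could not relax (`(U_h)`); the flux identity `⟨⟨θ_j v_j·∇h⟩⟩ = −‖h‖²` forces rough
vorticity through `{h ≠ 0}`. WHERE THE RIGIDITY SITS is the lead's first decision (triage r2-1 (ε)):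
a steep NS spectrum puts little ENERGY in the rough part of `v_j`, so in `L²` currency the decisive
statement is about the energy-carrying scales — "the large scales of a relaxing NS family admit no
smooth slow coboundary structure for `h`" — with the drifting geometry (`V = U e₁`, `χ = sin 2πx/(2πU)`
+ energetically small rough fluctuations) excluded by `FloorUpgrade.Negative.relaxation_speed_limit`
(‖h‖²(1 − √C e^{−γs/2}) ≤ 2G²E′s², co-moving Cesàro energy `E′`) and momentum conservation
(`IsGlobalLerayHopf.integral_eq_integral_of_hasZeroMean`). Useful identity (pair the `θ_j`-equation
with `χ_j`): `P_j = ⟨⟨r_j, θ_j − χ_j⟩⟩ + O(ν_j K)`. BENCHES (provable now, not registered): the exact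
steady case `v_j·∇χ = b` (⇒ `v_j = V + q_j(t,χ)∇⊥χ` leafwise) and the two semi-rough shear ansätze of
the card (S2: `W_xx + λW = d(x)` resp. the pressure argument) have uniformly bounded enstrophy. WHY IT
MIGHT FAIL: fine vorticity can hide where the tilting rate vanishes (the kinematic enemy puts its mixing
chamber on `{h = 0}`) and be ferried through `{h ≠ 0}` faster than it tilts — quantitative; over ALL
bounded-energy LH families (without `(U_h)`/no-floor) the statement would contain an open NS question
(steady large-scale `V` + energetically vanishing, enstrophically diverging fluctuations), which is why
every clause of the relaxing family and the no-floor hypothesis are kept. [folklore] -/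
theorem stub_orrTiltRigidity :
    ∀ (g : UnitAddTorus (Fin 2) → EuclideanSpace ℝ (Fin 2)) (h : UnitAddTorus (Fin 2) → ℝ) (ν : ℕ → ℝ)
      (v₀ : ℕ → UnitAddTorus (Fin 2) → EuclideanSpace ℝ (Fin 2))
      (v : ℕ → ℝ → UnitAddTorus (Fin 2) → EuclideanSpace ℝ (Fin 2)) (E C γ : ℝ),
      FunctionSpaces.Torus.IsSmooth g → FunctionSpaces.Torus.IsDivFree g →
      FunctionSpaces.Torus.HasZeroMean g → FunctionSpaces.Torus.IsSmooth h →
      FunctionSpaces.Torus.HasZeroMean h → h ≠ 0 →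
      (∀ j, 0 < ν j) → Tendsto ν atTop (𝓝 0) →
      (∀ j, IsGlobalLerayHopf (ν j) (fun _ => g) (v₀ j) (v j)) →
      (∀ (j : ℕ) (T : ℝ), 0 < T →
        MemLp (FunctionSpaces.Torus.stLift (v j)) ⊤ (volume.restrict (Ioo (0 : ℝ) T ×ˢ univ))) →
      (∀ j, meanEnergy (v j) ≤ E) → 0 ≤ C → 0 < γ →
      (∀ (j : ℕ) (s : ℝ), 0 ≤ s → ∀ (T : ℝ) (ϑ : ℝ → UnitAddTorus (Fin 2) → ℝ),
        IsWeakScalarTransportOn T (ν j) (fun t => v j (s + t)) h ϑ →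
          ∀ᵐ t ∂(volume.restrict (Ioo (0 : ℝ) T)),
            scalarL2Sq (ϑ t) ≤ C * Real.exp (-(γ * t)) * scalarL2Sq h) →
      ∀ (θ : ℕ → ℝ → UnitAddTorus (Fin 2) → ℝ),
      (∀ j, IsWeakScalarTransportForced (ν j) (v j) (fun _ => h) 0 (θ j)) →
      (∀ ε : ℝ, 0 < ε → ∀ᶠ j in atTop,
        longTimeAvgSup (fun t => ν j * (eScalarGradNormSq (θ j t)).toReal) < ε) →
      (∀ δ : ℝ, 0 < δ → ∃ (K : ℝ) (χ : ℕ → ℝ → UnitAddTorus (Fin 2) → ℝ),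
          (∀ j, FunctionSpaces.Torus.IsSmoothSpaceTimeOn (Ici (0 : ℝ)) (χ j)) ∧
          (∀ (j : ℕ) (t : ℝ), 0 ≤ t → ∀ x : UnitAddTorus (Fin 2),
            |χ j t x| ≤ K ∧ ‖FunctionSpaces.Torus.gradient (χ j t) x‖ ≤ K ∧
            (∀ i k : Fin 2,
              |FunctionSpaces.Torus.partialDeriv i (FunctionSpaces.Torus.partialDeriv k (χ j t)) x| ≤ K) ∧
            |FunctionSpaces.Torus.timeDerivWithin (Ici (0 : ℝ)) (χ j) t x| ≤ K ∧
            ‖FunctionSpaces.Torus.gradient (FunctionSpaces.Torus.timeDerivWithin (Ici (0 : ℝ)) (χ j) t) x‖ ≤ K) ∧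
          ∀ᶠ j in atTop, ∀ᶠ T in atTop,
            ∫⁻ t in Ioo (0 : ℝ) T, ∫⁻ x,
                ‖h x - (FunctionSpaces.Torus.timeDerivWithin (Ici (0 : ℝ)) (χ j) t x +
                  ⟪v j t x, FunctionSpaces.Torus.gradient (χ j t) x⟫_ℝ)‖ₑ ^ 2
              ≤ ENNReal.ofReal (δ * T)) →
      ∃ Z : ℝ, ∃ᶠ j in atTop, ∀ᶠ T in atTop,
        ∫⁻ t in Ioo (0 : ℝ) T, FunctionSpaces.Torus.eGradNormSq (v j t) ≤ ENNReal.ofReal (Z * T) := by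
  sorry

/-! ## Stub 4 (support, M–L): bounded enstrophy along a subsequence excludes uniform relaxation (Seis) -/

/-- **`stub_boundedEnstrophyNoRelaxation`** (Seis 2022 Remark 1 in the family form the line needs;
support-sized given the PROVED tree fact `Literature.Analysis.FluidPDE.Seis2022_rmk1_L2_holds`).
A family of global Leray–Hopf velocities `v_j` on `T²` (steady smooth mean-zero force `g`, viscosities
`ν_j > 0`, `ν_j → 0`, locally bounded on slabs) whose mean enstrophy is bounded ALONG A SUBSEQUENCE in
the eventual-Cesàro sense, `∃ᶠ j, ∫₀ᵀ ‖∇v_j‖²₂ ≤ Z T` for all large `T`, cannot relax a smooth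
mean-zero `h ≠ 0` `ν`-uniformly AND phase-uniformly with constants `(C, γ)` (the `(U_h)` clause of
`RelaxingFamily`, diffusivity `= ν_j`). Route: (i) rising-sun / one-sided maximal inequality on
`f = ‖∇v_j‖²`: from `∫₀ᵀ f ≤ Z T` (`T ≥ T₀(j)`) pick a phase `s_j` with `∫_{s_j}^{s_j+t} f ≤ 16 Z t`
for all `t > 0`, whence by Cauchy–Schwarz the Remark-1 budget `∫₀ᵗ ‖∇u_j‖ ≤ 4√Z (1+t)` for
`u_j := v_j(s_j + ·)` with `M = 4√Z` UNIFORM in `j`; (ii) per member, `u_j ∈ L^∞(ℝ₊; L²)`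
(Leray–Hopf energy inequality + Poincaré on the momentum-free part + momentum conservation
`IsGlobalLerayHopf.integral_eq_integral_of_hasZeroMean`; the bound may depend on `j`); (iii) a GLOBAL
release `ϑ_j` of `h` in `u_j` (window releases `IsGlobalLerayHopf.exists_release` glued by bounded-drift
uniqueness `KinematicSteadySourceLaw.ae_eq_of_memLp_top`) decays like `(√(C‖h‖²) e^{−γt/2})²` for a.e.
`t > 0` by `(U_h)` at phase `s_j` on the horizons `T = n`; (iv) `Seis2022_rmk1_L2_holds` with
`(a, b, B, C₀, M) = (‖h‖_{L¹}, ‖h‖_{L¹}, ‖∇h‖_{L¹}, √(C‖h‖²), 4√Z)` gives `γ/2 ≤ K/log(1/ν_j)` for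
every `j` of the subsequence with `ν_j ≤ κ₀` — contradiction with `ν_j → 0`, `γ > 0`
(`‖h‖_{L¹} > 0` since `h ≠ 0` is smooth). [cite: Seis2022, Remark 1 (p. 4); Thm 2] -/
theorem stub_boundedEnstrophyNoRelaxation :
    ∀ (g : UnitAddTorus (Fin 2) → EuclideanSpace ℝ (Fin 2)) (h : UnitAddTorus (Fin 2) → ℝ) (ν : ℕ → ℝ)
      (v₀ : ℕ → UnitAddTorus (Fin 2) → EuclideanSpace ℝ (Fin 2))
      (v : ℕ → ℝ → UnitAddTorus (Fin 2) → EuclideanSpace ℝ (Fin 2)) (C γ Z : ℝ),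
      FunctionSpaces.Torus.IsSmooth g → FunctionSpaces.Torus.HasZeroMean g →
      FunctionSpaces.Torus.IsSmooth h → FunctionSpaces.Torus.HasZeroMean h → h ≠ 0 →
      (∀ j, 0 < ν j) → Tendsto ν atTop (𝓝 0) →
      (∀ j, IsGlobalLerayHopf (ν j) (fun _ => g) (v₀ j) (v j)) →
      (∀ (j : ℕ) (T : ℝ), 0 < T →
        MemLp (FunctionSpaces.Torus.stLift (v j)) ⊤ (volume.restrict (Ioo (0 : ℝ) T ×ˢ univ))) →
      0 ≤ C → 0 < γ →
      (∀ (j : ℕ) (s : ℝ), 0 ≤ s → ∀ (T : ℝ) (ϑ : ℝ → UnitAddTorus (Fin 2) → ℝ),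
        IsWeakScalarTransportOn T (ν j) (fun t => v j (s + t)) h ϑ →
          ∀ᵐ t ∂(volume.restrict (Ioo (0 : ℝ) T)),
            scalarL2Sq (ϑ t) ≤ C * Real.exp (-(γ * t)) * scalarL2Sq h) →
      (∃ᶠ j in atTop, ∀ᶠ T in atTop,
        ∫⁻ t in Ioo (0 : ℝ) T, FunctionSpaces.Torus.eGradNormSq (v j t) ≤ ENNReal.ofReal (Z * T)) →
      False :=
  Theorems.FloorUpgradeMDD.stub_boundedEnstrophyNoRelaxation

/-! ## The composition (kernel-checked): `FloorUpgrade` from the four stubs -/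

/-- **The crux modulo the stubs.** Take the relaxing family of `hR`; its sourced scalars exist
(`stub_sourcedSolution`); if the same-family floor failed along the whole index set (negation of K1′),
`stub_slowTransferField` gives slow smooth transfer fields along a subfamily, `stub_orrTiltRigidity`
bounds the enstrophy of that subfamily along a further subsequence, and
`stub_boundedEnstrophyNoRelaxation` (Seis) contradicts `(U_h)`; hence K1′ holds, and extracting the
good subsequence (`Filter.extraction_of_frequently_atTop`; every clause of X is inherited, `ν ∘ ψ → 0`)
yields `UniformRelaxationWitness` with the family's own data. [folklore] -/
theorem FloorUpgrade_of : FloorUpgrade := by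
  rintro ⟨g, h, hg, hgdiv, hgmean, hh, hhmean, hh0, ν, v₀, v, hνpos, hνlim, hLH, hbd, ⟨E, hE⟩, C, γ,
    hC, hγ, hrelax⟩
  -- the `h`-sourced scalars of the family (zero datum, diffusivity `ν j`)
  choose θ hθ using fun j =>
    stub_sourcedSolution (ν j) (ν j) g h (v₀ j) (v j) (hνpos j) hh (hLH j) (hbd j)
  -- K1′ (same-family floor along a subsequence) for THIS family, by contradiction
  have key : ∃ ε : ℝ, 0 < ε ∧ ∃ᶠ j in atTop,
      ε ≤ longTimeAvgSup (fun t => ν j * (eScalarGradNormSq (θ j t)).toReal) := by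
    by_contra hcon
    -- no floor along the whole index set
    have hnof : ∀ ε : ℝ, 0 < ε → ∀ᶠ j in atTop,
        longTimeAvgSup (fun t => ν j * (eScalarGradNormSq (θ j t)).toReal) < ε := by
      intro ε hε
      have h1 : ¬ ∃ᶠ j in atTop,
          ε ≤ longTimeAvgSup (fun t => ν j * (eScalarGradNormSq (θ j t)).toReal) :=
        fun hf => hcon ⟨ε, hε, hf⟩
      simpa only [Filter.not_frequently, not_le] using h1
    -- S4: slow smooth transfer fields along a subfamily `φ`
    obtain ⟨φ, hφ, hT⟩ :=
      stub_slowTransferField g h ν v₀ v E C γ hg hgdiv hgmean hh hhmean hh0 hνpos hνlim hLH hbd hE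
        hC hγ hrelax θ hθ hnof
    -- the subfamily is again a no-floor relaxing family
    have hφlim : Tendsto (fun j => ν (φ j)) atTop (𝓝 0) := hνlim.comp hφ.tendsto_atTop
    have hnof' : ∀ ε : ℝ, 0 < ε → ∀ᶠ j in atTop,
        longTimeAvgSup (fun t => ν (φ j) * (eScalarGradNormSq (θ (φ j) t)).toReal) < ε :=
      fun ε hε => hφ.tendsto_atTop.eventually (hnof ε hε)
    -- S3′: bounded enstrophy along a subsequence of the subfamily
    obtain ⟨Z, hZ⟩ :=
      stub_orrTiltRigidity g h (fun j => ν (φ j)) (fun j => v₀ (φ j)) (fun j => v (φ j)) E C γ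
        hg hgdiv hgmean hh hhmean hh0 (fun j => hνpos (φ j)) hφlim (fun j => hLH (φ j))
        (fun j => hbd (φ j)) (fun j => hE (φ j)) hC hγ (fun j s hs => hrelax (φ j) s hs)
        (fun j => θ (φ j)) (fun j => hθ (φ j)) hnof' hT
    -- Seis: contradiction with `(U_h)`
    exact stub_boundedEnstrophyNoRelaxation g h (fun j => ν (φ j)) (fun j => v₀ (φ j))
      (fun j => v (φ j)) C γ Z hg hgmean hh hhmean hh0 (fun j => hνpos (φ j)) hφlim
      (fun j => hLH (φ j)) (fun j => hbd (φ j)) hC hγ (fun j s hs => hrelax (φ j) s hs) hZ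
  -- extract the good subsequence: every clause of X is inherited
  obtain ⟨ε, hε, hfreq⟩ := key
  obtain ⟨ψ, hψ, hψP⟩ := Filter.extraction_of_frequently_atTop hfreq
  exact ⟨g, h, hg, hgdiv, hgmean, hh, hhmean, fun j => ν (ψ j), fun j => v₀ (ψ j),
    fun j => v (ψ j), fun j => hνpos (ψ j), hνlim.comp hψ.tendsto_atTop, fun j => hLH (ψ j),
    fun j => hbd (ψ j), ⟨E, fun j => hE (ψ j)⟩, ⟨C, γ, hC, hγ, fun j s hs => hrelax (ψ j) s hs⟩,
    ε, hε, fun j => ⟨θ (ψ j), hθ (ψ j), hψP j⟩⟩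

end Summit.AnomalousDissipation.AnomalousDissipation.Cruxes.FloorUpgrade.MaterialDerivativeDichotomy

end
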